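import Summits.BirchSwinnertonDyer.Rank1Residual.AdditivePotMult.Descent
import Literature.NumberTheory.EllipticCurves.OpenImage
import HarnessLib

/-!
# X3♯(M): the prime support of the reducible potentially multiplicative cell (Mazur 1978)

HONEST FRAMING (cell `b2b-bsdres`, run/shared/lean/b2b/bsd-rank1-residual/, verbatim in every
file): the goal of the cell is to DELETE the COMBINATION-SHAPED residual classes of the
Birch–Swinnerton-Dyer formula for ALL analytic-rank `≤ 1` elliptic curves over `ℚ` — "full BSD
formula for every rank `≤ 1` curve in class `C`" assembled STRICTLY from published theorems — so
that the rank-`≤ 1` remainder becomes exactly the CONSTRUCTION-SHAPED classes, which are TYPED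
(missing-input `Prop`s), NOT attempted. This is not "finishing BSD". Sub-cell `additive-p1`,
generation 14: research route; theorems only, no definition, no new named fact (Mazur 1978 Thm. 1
enters as the tree's named fact `mazur_isogeny_irreducible`, hypothesis `hM`); X3♯(M) stays
CONSTRUCTION-SHAPED; no label moves; nothing booked.

WHAT THIS FILE DOES. The class `ClassX3M W p` (`E[p]` REDUCIBLE, additive potentially multiplicative
at `p`, `p ≠ 2`) can only occur at a Mazur prime: `E[p]` reducible means a `ℚ`-rational `p`-isogeny,
so `p ∈ {2, 3, 5, 7, 11, 13, 17, 19, 37, 43, 67, 163}` (Mazur 1978 Thm. 1), and `p ≠ 2` by the class: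
`ClassX3M.mem_mazurPrimes`, `ClassX3M.three_le`, `ClassX3M.le_163`. (The census header of
RESIDUAL-MAP §E, "X3 ∩ pot-mult: 3, 5, 7, (13 …)", is sharper: at `p ∈ {11, 17, 19, 37, 43, 67, 163}`
the finitely many isogeny `j`-invariants are `p`-integral, so (M) — `ord_p j < 0` — excludes them;
that refinement needs the explicit `j`-table of the non-cuspidal rational points of `X₀(p)`, which is
not in the tree — `-- TODO(general form)` below.)

References: [Mazur1978] Thm. 1.
-/

noncomputable section

open scoped Classical

open WeierstrassCurve Literature.NumberTheory.EllipticCurves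
  Literature.NumberTheory.EllipticCurves.Rank1Residual

namespace Summit.BirchSwinnertonDyer.Rank1Residual.AdditivePotMult

variable {W : WeierstrassCurve ℚ} [W.IsElliptic] [W.IsGloballyMinimal] {p : ℕ} [hp : Fact p.Prime]

omit [W.IsGloballyMinimal] in
/-- **A reducible `E[p]` forces a Mazur prime**: under Mazur 1978 Thm. 1 (`hM`), `Red W p` (the
class-X3 bit "`E[p]` reducible") implies `p ∈ {2, 3, 5, 7, 11, 13, 17, 19, 37, 43, 67, 163}`.
[cite: Mazur1978, Thm 1] -/
theorem Red.mem_mazurPrimes (hM : mazur_isogeny_irreducible) (hred : Red W p) : p ∈ mazurPrimes := by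
  by_contra h
  exact hred (hM W p hp.out h)

/-- **X3♯(M) lives at the odd Mazur primes**: `ClassX3M W p → p ∈ {2, 3, 5, …, 163}` (and `p ≠ 2`
by the class). [cite: Mazur1978, Thm 1] -/
theorem ClassX3M.mem_mazurPrimes (hM : mazur_isogeny_irreducible) (hX : ClassX3M W p) :
    p ∈ mazurPrimes :=
  Red.mem_mazurPrimes hM hX.classX3.1

/-- X3♯(M): `3 ≤ p` (a Mazur prime other than `2`). [cite: Mazur1978, Thm 1] -/
theorem ClassX3M.three_le (hM : mazur_isogeny_irreducible) (hX : ClassX3M W p) : 3 ≤ p := by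
  have hmem := hX.mem_mazurPrimes hM
  have h2 := hX.p_ne_two
  simp only [mazurPrimes, Finset.mem_insert, Finset.mem_singleton] at hmem
  omega

/-- X3♯(M): `p ≤ 163`. [cite: Mazur1978, Thm 1] -/
theorem ClassX3M.le_163 (hM : mazur_isogeny_irreducible) (hX : ClassX3M W p) : p ≤ 163 :=
  le_of_mem_mazurPrimes (hX.mem_mazurPrimes hM)

/-- X3♯(M): the explicit disjunction `p = 3 ∨ p = 5 ∨ … ∨ p = 163` (eleven odd Mazur primes).
[cite: Mazur1978, Thm 1] -/
theorem ClassX3M.prime_cases (hM : mazur_isogeny_irreducible) (hX : ClassX3M W p) :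
    p = 3 ∨ p = 5 ∨ p = 7 ∨ p = 11 ∨ p = 13 ∨ p = 17 ∨ p = 19 ∨ p = 37 ∨ p = 43 ∨ p = 67 ∨
      p = 163 := by
  have hmem := hX.mem_mazurPrimes hM
  have h2 := hX.p_ne_two
  simp only [mazurPrimes, Finset.mem_insert, Finset.mem_singleton] at hmem
  omega

-- TODO(general form): `ClassX3M W p → p ∈ {3, 5, 7, 13}` — needs the explicit `j`-invariants of the
-- non-cuspidal rational points of `X₀(p)` for `p ∈ {11, 17, 19, 37, 43, 67, 163}` (all `p`-integral),
-- a published table not yet in the tree.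

end Summit.BirchSwinnertonDyer.Rank1Residual.AdditivePotMult

end
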